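import Summits.Schanuel.Schanuel.Theorems.DiophantineDichotomyKhovanskiiApproxTypeEvPairSumMeasure

/-!
# The pair-sum hardness certificate of the naive LW layer at EVERY rank `n ≥ 3`

Line `Sketch` of crux `DiophantineDichotomy.KhovanskiiApproxTypeEv` (stmt-Schanuel-14972), lead
`prover-line-stmt-Schanuel-14972-c11-0` — `--supports`.  The rank-3 certificate `stub_pairSumMeasure`
(`…EvPairSumMeasure.lean`, p146020) run at rank `n`: stub B of the skeleton (`∀ n ≥ 3, EvLW n`, leaf
`LWLayerRankThreeUp`) implies, at every Lindemann–Weierstrass `n`-tuple `s ∈ ℚ̄ⁿ` with `ℚ`-linearly independent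
coordinates, that `n` INDEPENDENT algebraic numbers `α_j` of degree `≤ k` and naive height `≤ h` cannot have all cyclic
pair sums `α_j + α_{j+1}` within `exp(−C k^κ log h)` of `e^{s_j}`, for some `κ < (2n−1)/(n−1) = 1 + n/(n−1)` and all
`h ≥ h₀(k)`: the challenger `(s, (α_j + α_{j+1})_j)` has level `(N_s kⁿ, 4^{k²}((k+1)h)^{2k})`, so the crux's
`dᵃ log H` is `≍ k^{na+1} log h` with `a < 1/(n−1)`.  The printed exponent for this species is `3` at every rank
(Ably 1994 at `m = 1` / `evLWDh` on one pair sum of degree `k²` and height `h^{2k}`), so the certified exponent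
`κ_n < (2n−1)/(n−1) ↘ 2` sharpens with the rank; for ODD `n` the cyclic pair-sum map is invertible (circulant
`I + P`, eigenvalues `1 + ωʲ ≠ 0`), so the conclusion is a genuine simultaneous-approximation statement about the
`n` numbers `ξ = (I + P)⁻¹ e^{s}` (values of order-`n` exponential sums), heuristically of true exponent `1`; for even
`n` it is trivially true (`Σ (−1)ʲ (α_j + α_{j+1}) = 0 ≠ Σ (−1)ʲ e^{s_j}` by Lindemann–Weierstrass) and carries no
content.  Everything here is proved; no named facts.
-/

noncomputable section

set_option linter.dupNamespace false -- mandated summit/sub-problem namespace (single-conjunct summit)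

namespace Summit.Schanuel.Schanuel.Cruxes.KhovanskiiApproxTypeEv.AnchoredReduction

open Summit.Schanuel.Schanuel.Theses.DiophantineDichotomy (KhovanskiiApproxTypeEv)
open Summit.Schanuel.Schanuel.Cruxes.KhovanskiiApproxTypeEv.RareFieldSpecies
  (EvLW khovanskiiApproxTypeEv_iff_threeLayers)
open Polynomial

/-- Sup-norm bookkeeping at rank `n`: a challenger whose `z`-part is EXACTLY `s` is as far from `θ = (s, e^s)` as
its `y`-part is from `e^s`. [folklore] -/
theorem norm_elim_sub_le_rank {n : ℕ} (s : Fin n → ℂ) (σ : Fin n → ℂ) :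
    ‖(Sum.elim s σ : Fin n ⊕ Fin n → ℂ) - Sum.elim s (Complex.exp ∘ s)‖ ≤
      ‖fun j : Fin n => σ j - Complex.exp (s j)‖ := by
  refine (pi_norm_le_iff_of_nonneg (norm_nonneg _)).2 ?_
  rintro (i | j)
  · simp
  · simpa using norm_le_pi_norm (fun j : Fin n => σ j - Complex.exp (s j)) j

/-- **THE PAIR-SUM CERTIFICATE AT RANK `n ≥ 3`**: `EvLW n` implies, at every LW `n`-tuple, a simultaneous measure for
INDEPENDENT degree-`k` approximation of `e^{s_j}` by cyclic pair sums `α_j + α_{j+1}` (`j+1 = finRotate n j`) with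
degree exponent `κ < (2n−1)/(n−1)`; print gives `κ = 3` at every rank.  Same proof as `stub_pairSumMeasure`
(rank 3): challenger `(s, (α_j + α_{j+1})_j)` of level `(N kⁿ, 4^{k²}((k+1)h)^{2k})` past the threshold
`h ≥ max(H₀(d), H_s, 4^k(k+1), exp(dᵇ))`. [folklore] -/
theorem pairSum_measure_of_evLW {n : ℕ} (hn : 3 ≤ n) (h : EvLW n) (s : Fin n → ℂ)
    (halg : ∀ i, IsAlgebraic ℚ (s i)) (hli : LinearIndependent ℚ s) :
    ∃ κ C : ℝ, κ < (2 * n - 1) / ((n : ℝ) - 1) ∧ 0 < C ∧ ∀ k : ℕ, ∃ h₀ : ℕ, ∀ (H : ℕ) (α : Fin n → ℂ),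
      h₀ ≤ H →
      (∀ j, ∃ P : Polynomial ℤ, P ≠ 0 ∧ P.natDegree ≤ k ∧ (∀ l, |P.coeff l| ≤ (H : ℤ)) ∧
        Polynomial.aeval (α j) P = 0) →
      Real.exp (-(C * (k : ℝ) ^ κ * Real.log H)) ≤
        ‖fun j : Fin n => α j + α (finRotate n j) - Complex.exp (s j)‖ := by
  obtain ⟨a, b, C, ha, hC, hall⟩ := h s halg hli
  have hn1 : (0 : ℝ) < (n : ℝ) - 1 := by
    have : (3 : ℝ) ≤ n := by exact_mod_cast hn
    linarith
  -- fixed data of the LW point: integer annihilators of the `s i` and the degree of `ℚ(s)`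
  have hT : ∀ i, ∃ (T : Polynomial ℤ) (B : ℕ), T ≠ 0 ∧ (∀ l, |T.coeff l| ≤ (B : ℤ)) ∧
      Polynomial.aeval (s i) T = 0 := fun i => exists_intPoly_bound_of_isAlgebraic (halg i)
  choose T B hT0 hTB hTroot using hT
  set Ks : IntermediateField ℚ ℂ := IntermediateField.adjoin ℚ (Set.range s) with hKs
  haveI : FiniteDimensional ℚ Ks := by
    haveI : Finite (Set.range s) := Set.finite_range s |>.to_subtype
    exact IntermediateField.finiteDimensional_adjoin (fun x hx => by
      obtain ⟨i, rfl⟩ := hx; exact (halg i).isIntegral)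
  set M : ℕ := Module.finrank ℚ Ks with hM
  have hM1 : 1 ≤ M := Module.finrank_pos
  set N : ℕ := M + ∑ i, (T i).natDegree with hN
  have hMN : M ≤ N := Nat.le_add_right _ _
  have hN1 : 1 ≤ N := hM1.trans hMN
  have hTdeg : ∀ i, (T i).natDegree ≤ N := fun i =>
    le_trans (Finset.single_le_sum (f := fun i => (T i).natDegree) (fun _ _ => Nat.zero_le _)
      (Finset.mem_univ i)) (Nat.le_add_left _ _)
  set Hs : ℕ := ∑ i, B i with hHs
  have hBHs : ∀ i, B i ≤ Hs := fun i =>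
    Finset.single_le_sum (f := B) (fun _ _ => Nat.zero_le _) (Finset.mem_univ i)
  -- the constants
  set a' : ℝ := max a 0 with ha'
  have ha'0 : 0 ≤ a' := le_max_right _ _
  have ha'1 : a' < 1 / ((n : ℝ) - 1) := max_lt ha (by positivity)
  have hN1r : (1 : ℝ) ≤ N := by exact_mod_cast hN1
  have hNa : 1 ≤ (N : ℝ) ^ a' := Real.one_le_rpow hN1r ha'0
  have hκ : (n : ℝ) * a' + 1 < (2 * n - 1) / ((n : ℝ) - 1) := by
    rw [lt_div_iff₀ hn1]
    have h1 : a' * ((n : ℝ) - 1) < 1 := by rwa [lt_div_iff₀ hn1] at ha'1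
    have hn0 : (0 : ℝ) < n := by linarith
    nlinarith [mul_lt_mul_of_pos_left h1 hn0]
  refine ⟨(n : ℝ) * a' + 1, 6 * C * (N : ℝ) ^ a', hκ, by positivity, fun k => ?_⟩
  -- degree budget `k = 0` is vacuous
  rcases Nat.eq_zero_or_pos k with hk0 | hk
  · refine ⟨0, fun H α _ hcl => ?_⟩
    have := one_le_budget_of_clause (hcl ⟨0, by omega⟩)
    omega
  -- the level of the pair-sum challenger and the threshold
  set d : ℕ := N * k ^ n with hd
  obtain ⟨H₀, hH₀⟩ := hall d
  refine ⟨max (max H₀ Hs) (max (4 ^ k * (k + 1)) ⌈Real.exp (((d : ℕ) : ℝ) ^ b)⌉₊),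
    fun H α hH hcl => ?_⟩
  have hH0 : H₀ ≤ H := le_trans (le_trans (le_max_left _ _) (le_max_left _ _)) hH
  have hHs : Hs ≤ H := le_trans (le_trans (le_max_right _ _) (le_max_left _ _)) hH
  have hH4 : 4 ^ k * (k + 1) ≤ H := le_trans (le_trans (le_max_left _ _) (le_max_right _ _)) hH
  have hHb : ⌈Real.exp (((d : ℕ) : ℝ) ^ b)⌉₊ ≤ H :=
    le_trans (le_trans (le_max_right _ _) (le_max_right _ _)) hH
  have hH2 : 2 ≤ H := le_trans (le_trans (by
    calc 2 ≤ 4 ^ k := le_trans (by norm_num) (Nat.pow_le_pow_right (by norm_num) hk)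
      _ ≤ 4 ^ k * (k + 1) := Nat.le_mul_of_pos_right _ (by omega)) (le_max_left _ _))
    (le_trans (le_max_right _ _) hH)
  have hH1r : (1 : ℝ) < H := by exact_mod_cast hH2
  have hHpos : (0 : ℝ) < H := by positivity
  have hlogH : 0 < Real.log H := Real.log_pos hH1r
  -- the level height
  set L : ℕ := 4 ^ (k * k) * ((k + 1) * H) ^ k * ((k + 1) * H) ^ k with hL
  have hLpow : L ≤ H ^ (5 * k) := levelHeight_le_pow hk hH4
  have hHL : H ≤ L := by
    have h1 : 1 ≤ 4 ^ (k * k) := Nat.one_le_pow _ _ (by norm_num)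
    have h2 : H ≤ ((k + 1) * H) ^ k := by
      calc H ≤ (k + 1) * H := Nat.le_mul_of_pos_left _ (by omega)
        _ ≤ ((k + 1) * H) ^ k := Nat.le_self_pow (by omega) _
    have h3 : 1 ≤ ((k + 1) * H) ^ k := le_trans (by omega) h2
    calc H ≤ ((k + 1) * H) ^ k := h2
      _ = 1 * ((k + 1) * H) ^ k * 1 := by ring
      _ ≤ 4 ^ (k * k) * ((k + 1) * H) ^ k * ((k + 1) * H) ^ k :=
        Nat.mul_le_mul (Nat.mul_le_mul h1 le_rfl) h3
  have hL0 : H₀ ≤ L := hH0.trans hHL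
  have hLpos : (0 : ℝ) < L := by exact_mod_cast (lt_of_lt_of_le (by omega) hHL : 0 < L)
  have hlogL : Real.log L ≤ 5 * k * Real.log H := by
    have h1 : (L : ℝ) ≤ (H : ℝ) ^ (5 * k) := by exact_mod_cast hLpow
    calc Real.log L ≤ Real.log ((H : ℝ) ^ (5 * k)) := Real.log_le_log hLpos h1
      _ = 5 * k * Real.log H := by rw [Real.log_pow]; push_cast; ring
  -- the challenger `γ = (s, (α_j + α_{j+1})_j)` and its admissibility at level `(d, L)`
  set σ : Fin n → ℂ := fun j => α j + α (finRotate n j) with hσ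
  set γ : Fin n ⊕ Fin n → ℂ := Sum.elim s σ with hγ
  have hkn : 1 ≤ k ^ n := Nat.one_le_pow _ _ hk
  have hNd : N ≤ d := by rw [hd]; exact Nat.le_mul_of_pos_right _ hkn
  have hkkd : k * k ≤ d := by
    calc k * k = k ^ 2 := (sq k).symm
      _ ≤ k ^ n := Nat.pow_le_pow_right hk (by omega)
      _ ≤ N * k ^ n := Nat.le_mul_of_pos_left _ hN1
  have hclause : ∀ i, ∃ P : Polynomial ℤ, P ≠ 0 ∧ P.natDegree ≤ d ∧ (∀ l, |P.coeff l| ≤ (L : ℤ)) ∧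
      Polynomial.aeval (γ i) P = 0 := by
    rintro (i | j)
    · refine ⟨T i, hT0 i, (hTdeg i).trans hNd, fun l => (hTB i l).trans ?_, hTroot i⟩
      exact_mod_cast (hBHs i).trans (hHs.trans hHL)
    · obtain ⟨R, hR0, hRdeg, hRH, hRroot⟩ := stub_clauseAdd (hcl j) (hcl (finRotate n j))
      exact ⟨R, hR0, hRdeg.trans hkkd, fun l => by simpa [hL] using hRH l, hRroot⟩
  have hfr : Module.finrank ℚ ↥(IntermediateField.adjoin ℚ (Set.range γ)) ≤ d := by
    set Kα : IntermediateField ℚ ℂ := IntermediateField.adjoin ℚ (Set.range α) with hKα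
    have hint : ∀ j, IsIntegral ℚ (α j) := by
      intro j
      obtain ⟨P, hP0, -, -, hroot⟩ := hcl j
      refine (isAlgebraic_iff_isIntegral.mp ⟨P.map (algebraMap ℤ ℚ), ?_, ?_⟩)
      · exact (Polynomial.map_ne_zero_iff (algebraMap ℤ ℚ).injective_int).mpr hP0
      · rw [Polynomial.aeval_map_algebraMap]; exact hroot
    haveI : FiniteDimensional ℚ Kα := by
      haveI : Finite (Set.range α) := Set.finite_range α |>.to_subtype
      exact IntermediateField.finiteDimensional_adjoin (fun x hx => by
        obtain ⟨j, rfl⟩ := hx; exact hint j)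
    have hKα : Module.finrank ℚ Kα ≤ k ^ n := by
      have h := stub_finrankAdjoinRangeLe α (fun _ => k)
        (fun j => by obtain ⟨P, hP0, hdeg, -, hroot⟩ := hcl j; exact ⟨P, hP0, hdeg, hroot⟩)
      simpa [Finset.prod_const, Finset.card_univ, Fintype.card_fin] using h
    have hle : IntermediateField.adjoin ℚ (Set.range γ) ≤ Ks ⊔ Kα := by
      rw [IntermediateField.adjoin_le_iff]
      rintro _ ⟨i | j, rfl⟩
      · exact (le_sup_left : Ks ≤ Ks ⊔ Kα) (IntermediateField.subset_adjoin ℚ _ ⟨i, rfl⟩)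
      · have hα : ∀ j', α j' ∈ Ks ⊔ Kα := fun j' =>
          (le_sup_right : Kα ≤ Ks ⊔ Kα) (IntermediateField.subset_adjoin ℚ _ ⟨j', rfl⟩)
        exact add_mem (hα j) (hα (finRotate n j))
    calc Module.finrank ℚ ↥(IntermediateField.adjoin ℚ (Set.range γ))
        ≤ Module.finrank ℚ ↥(Ks ⊔ Kα) := IntermediateField.finrank_le_of_le_right hle
      _ ≤ Module.finrank ℚ Ks * Module.finrank ℚ Kα := IntermediateField.finrank_sup_le Ks Kα
      _ ≤ N * k ^ n := Nat.mul_le_mul hMN hKα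
  -- the crux's bound at level `(d, L)`
  have hmain := hH₀ L γ hL0 hfr hclause
  -- compare the exponents: `C (dᵃ log L + dᵇ) ≤ 6 C Nᵃ' k^{na'+1} log H`
  have hd1 : (1 : ℝ) ≤ d := by exact_mod_cast hN1.trans hNd
  have hdcast : (d : ℝ) = (N : ℝ) * (k : ℝ) ^ (n : ℕ) := by rw [hd]; push_cast; ring
  have hk0r : (0 : ℝ) ≤ k := Nat.cast_nonneg k
  have hk1r : (1 : ℝ) ≤ k := by exact_mod_cast hk
  have hda : (d : ℝ) ^ a ≤ (d : ℝ) ^ a' := Real.rpow_le_rpow_of_exponent_le hd1 (le_max_left _ _)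
  have hda' : (d : ℝ) ^ a' = (N : ℝ) ^ a' * (k : ℝ) ^ ((n : ℝ) * a') := by
    rw [hdcast, Real.mul_rpow (by positivity) (by positivity), ← Real.rpow_natCast,
      ← Real.rpow_mul hk0r]
  have hkκ : (k : ℝ) ^ ((n : ℝ) * a') * k = (k : ℝ) ^ ((n : ℝ) * a' + 1) := by
    rw [Real.rpow_add_one (by positivity)]
  have hna0 : 0 ≤ (n : ℝ) * a' := mul_nonneg (Nat.cast_nonneg n) ha'0
  have hkκ1 : 1 ≤ (k : ℝ) ^ ((n : ℝ) * a' + 1) := Real.one_le_rpow hk1r (by linarith)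
  have hdb : ((d : ℕ) : ℝ) ^ b ≤ Real.log H := by
    rw [Real.le_log_iff_exp_le hHpos]
    exact (Nat.le_ceil _).trans (by exact_mod_cast hHb)
  have hlogL0 : 0 ≤ Real.log L :=
    Real.log_nonneg (by exact_mod_cast (lt_of_lt_of_le (by omega) hHL : 0 < L))
  have key : C * ((d : ℝ) ^ a * Real.log L + (d : ℝ) ^ b) ≤
      6 * C * (N : ℝ) ^ a' * (k : ℝ) ^ ((n : ℝ) * a' + 1) * Real.log H := by
    have h1 : (d : ℝ) ^ a * Real.log L ≤
        (N : ℝ) ^ a' * (k : ℝ) ^ ((n : ℝ) * a') * (5 * k * Real.log H) := by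
      calc (d : ℝ) ^ a * Real.log L ≤ (d : ℝ) ^ a' * Real.log L :=
            mul_le_mul_of_nonneg_right hda hlogL0
        _ ≤ (d : ℝ) ^ a' * (5 * k * Real.log H) :=
            mul_le_mul_of_nonneg_left hlogL (by positivity)
        _ = (N : ℝ) ^ a' * (k : ℝ) ^ ((n : ℝ) * a') * (5 * k * Real.log H) := by rw [hda']
    have h1' : (d : ℝ) ^ a * Real.log L ≤
        5 * ((N : ℝ) ^ a' * (k : ℝ) ^ ((n : ℝ) * a' + 1) * Real.log H) := by
      calc (d : ℝ) ^ a * Real.log L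
          ≤ (N : ℝ) ^ a' * (k : ℝ) ^ ((n : ℝ) * a') * (5 * k * Real.log H) := h1
        _ = 5 * ((N : ℝ) ^ a' * ((k : ℝ) ^ ((n : ℝ) * a') * k) * Real.log H) := by ring
        _ = 5 * ((N : ℝ) ^ a' * (k : ℝ) ^ ((n : ℝ) * a' + 1) * Real.log H) := by rw [hkκ]
    have h2 : (d : ℝ) ^ b ≤ (N : ℝ) ^ a' * (k : ℝ) ^ ((n : ℝ) * a' + 1) * Real.log H := by
      calc (d : ℝ) ^ b ≤ Real.log H := hdb
        _ = 1 * 1 * Real.log H := by ring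
        _ ≤ (N : ℝ) ^ a' * (k : ℝ) ^ ((n : ℝ) * a' + 1) * Real.log H :=
            mul_le_mul_of_nonneg_right (mul_le_mul hNa hkκ1 zero_le_one (by positivity)) hlogH.le
    nlinarith [h1', h2, hC]
  calc Real.exp (-(6 * C * (N : ℝ) ^ a' * (k : ℝ) ^ ((n : ℝ) * a' + 1) * Real.log H))
      ≤ Real.exp (-(C * ((d : ℝ) ^ a * Real.log L + (d : ℝ) ^ b))) :=
        Real.exp_le_exp.2 (neg_le_neg key)
    _ ≤ ‖γ - Sum.elim s (Complex.exp ∘ s)‖ := hmain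
    _ ≤ ‖fun j : Fin n => σ j - Complex.exp (s j)‖ := norm_elim_sub_le_rank s σ

/-- **The certificate from stub B of the skeleton** (`∀ n ≥ 3, EvLW n`, leaf `LWLayerRankThreeUp`): at every rank
`n ≥ 3` and every LW `n`-tuple, the cyclic pair-sum measure with `κ < (2n−1)/(n−1)` (print: `3`). [folklore] -/
theorem pairSum_measure_of_evLW_rankThreeUp (hB : ∀ n : ℕ, 3 ≤ n → EvLW n) {n : ℕ} (hn : 3 ≤ n)
    (s : Fin n → ℂ) (halg : ∀ i, IsAlgebraic ℚ (s i)) (hli : LinearIndependent ℚ s) :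
    ∃ κ C : ℝ, κ < (2 * n - 1) / ((n : ℝ) - 1) ∧ 0 < C ∧ ∀ k : ℕ, ∃ h₀ : ℕ, ∀ (H : ℕ) (α : Fin n → ℂ),
      h₀ ≤ H →
      (∀ j, ∃ P : Polynomial ℤ, P ≠ 0 ∧ P.natDegree ≤ k ∧ (∀ l, |P.coeff l| ≤ (H : ℤ)) ∧
        Polynomial.aeval (α j) P = 0) →
      Real.exp (-(C * (k : ℝ) ^ κ * Real.log H)) ≤
        ‖fun j : Fin n => α j + α (finRotate n j) - Complex.exp (s j)‖ :=
  pairSum_measure_of_evLW hn (hB n hn) s halg hli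

/-- **The certificate from the crux itself** at every rank `n ≥ 3` (`khovanskiiApproxTypeEv_iff_threeLayers`,
p136816). [folklore] -/
theorem pairSum_measure_rank_of_khovanskiiApproxTypeEv (h : KhovanskiiApproxTypeEv) {n : ℕ} (hn : 3 ≤ n)
    (s : Fin n → ℂ) (halg : ∀ i, IsAlgebraic ℚ (s i)) (hli : LinearIndependent ℚ s) :
    ∃ κ C : ℝ, κ < (2 * n - 1) / ((n : ℝ) - 1) ∧ 0 < C ∧ ∀ k : ℕ, ∃ h₀ : ℕ, ∀ (H : ℕ) (α : Fin n → ℂ),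
      h₀ ≤ H →
      (∀ j, ∃ P : Polynomial ℤ, P ≠ 0 ∧ P.natDegree ≤ k ∧ (∀ l, |P.coeff l| ≤ (H : ℤ)) ∧
        Polynomial.aeval (α j) P = 0) →
      Real.exp (-(C * (k : ℝ) ^ κ * Real.log H)) ≤
        ‖fun j : Fin n => α j + α (finRotate n j) - Complex.exp (s j)‖ :=
  pairSum_measure_of_evLW hn ((khovanskiiApproxTypeEv_iff_threeLayers.1 h).2.1 n hn) s halg hli

end Summit.Schanuel.Schanuel.Cruxes.KhovanskiiApproxTypeEv.AnchoredReduction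

end
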